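import Literature.NumberTheory.Automorphic.LocalHermitianFormsRankThree
import Literature.NumberTheory.Automorphic.LocalUnitaryGroupCongr
import Literature.NumberTheory.Rogawski1990.StableConjugacyU3
import HarnessLib

/-!
# Local similitudes at EVERY finite place, and the correspondence `γ′ ↔ T⁻¹ γ′ T` they induce
(Rogawski, *Automorphic Representations of Unitary Groups in Three Variables* (1990), §14.1–14.2 p. 232; Platonov–Rapinchuk
(1994), §2.3; Mok (2015), §1)

Topic `NumberTheory/Automorphic`; namespace `Literature.NumberTheory.Automorphic.UnitaryGroup`. THEOREMS ONLY (no definition, no named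
fact, no instance, no notation). Continuation of `LocalUnitaryGroupCongr` ∕ `LocalHermitianFormsRankThree` (ENGINE T1 of the cell
`hodgecm-mathlib`, line `F0_T1InnerFormTraceIdentity`, stub S2 «`U(H)(L⁺_v) ≃ₜ* U(Φ₃)(L⁺_v)` at every finite `v`»).

The local transfer (14.2.1) compares stable orbital integrals at `γ ∈ U(Φ₃)(L⁺_v)` and `γ′ ∈ U(H)(L⁺_v)` with `γ′ ↔ γ`, where `↔` is
conjugacy in the common `GL₃(L ⊗ L⁺_v)` (★ `Rogawski1990.Corresponds`). An ABSTRACT isomorphism of topological groups (what S2's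
`Nonempty (… ≃ₜ* …)` provides; at split places the tree's ★ `localSplitCongr` is a composite of two split frames) need not preserve these
classes. This file supplies, at EVERY finite place, an isomorphism that is CONJUGATION BY A LOCAL SIMILITUDE `T ∈ GL_N(E ⊗_F F_v)` —
so that `γ′ ↔ ψ_v(γ′)` holds by definition:

* §1 **split places** (new; any rank): for `w ∣ v` with `c • w ≠ w` and `J, J'` `c`-hermitian with unit determinants there is
  `T ∈ GL_N(E_v)` with `ᵗ((c ⊗ 1) T) · J_v · T = J'_v` (`exists_formCongr_eq_of_split`): on `E_v = E_w × E_{c⁻¹ w}` take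
  `T = (1, c⁻¹_*(J_w^{-ᵀ} J'_w^{ᵀ}))`; the identity at `w` is `(J_w^{-ᵀ} J'_w^{ᵀ})ᵀ J_w = J'_w`, the one at `c⁻¹ w` is its
  `c⁻¹`-transport transposed (the «one equation suffices» mechanism of ★ `mem_localPi_iff_of_split`);
* §2 **`γ′ ↔ T γ′ T⁻¹`**: `corresponds_localFormCongr`, `corresponds_localFormCongr_symm` (and the `cmDatum` twins) — along the
  conjugation isomorphism ★ `localFormCongr c v T ha h : U(J')(F_v) ≃ₜ* U(J)(F_v)` of a local similitude every element corresponds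
  to its image (conjugator `T`; `coe_localFormCongr_apply` is `rfl`);
* §3 **CM, rank 3, every finite place**: for `H ∈ M₃(L)` anisotropic hermitian, at EVERY finite `v` of `L⁺` there are
  `T ∈ GL₃(L ⊗ L⁺_v)` and a `(c ⊗ 1)`-fixed unit `a` with `ᵗ(T̄) · H_v · T = a • (Φ₃)_v` (`exists_isUnit_formCongr_cmDatum_antidiagThree`;
  split `v`: §1 with `a = 1`; non-split `v`: ★ `exists_formCongr_map_eq_smul_antidiag_of_smul_eq`), hence
  `exists_cmDatum_localEquiv_corresponds`: an isomorphism `e : U(H)(L⁺_v) ≃ₜ* U(Φ₃)(L⁺_v)`, `e g = T⁻¹ g T`, with `γ′ ↔ e γ′` and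
  `e⁻¹ γ ↔ γ` for all `γ′, γ` — the socket the line's anchored transfer at `v ∈ S₀` is written against [Rogawski1990, §14.2 (14.2.1)].

## References
* J. Rogawski, Ann. of Math. Stud. 123 (1990), §14.1–14.2 p. 232 (print) [Rogawski1990].
* V. Platonov, A. Rapinchuk, *Algebraic Groups and Number Theory* (1994), §2.3, §5.1 [PlatonovRapinchuk1994].
* C. P. Mok, Mem. AMS 235 (2015), §1 Notation p. 5 [Mok2014].
-/

set_option autoImplicit false

noncomputable section

open NumberField IsDedekindDomain
open Literature.AlgebraicGeometry.ShimuraVarieties (hermForm)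
open Literature.NumberTheory.Rogawski1990 (Corresponds corresponds_comm)
open scoped Matrix MatrixGroups

namespace Literature.NumberTheory.Automorphic

namespace UnitaryGroup

section Generic

variable {F E : Type} [Field F] [NumberField F] [Field E] [NumberField E] [Algebra F E]
  (c : E ≃ₐ[F] E) {N : ℕ}

/-! ## §1 Split places: any two non-degenerate hermitian forms are congruent over `E_v = E_w × E_{c⁻¹ w}` -/

section Split

variable [Algebra.IsQuadraticExtension F E] {J J' : Matrix (Fin N) (Fin N) E} {v : HeightOneSpectrum (𝓞 F)}

omit [Algebra.IsQuadraticExtension F E] in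
/-- Componentwise reading of a local change of form: for `u ∈ Π_{w ∣ v} GL_N(E_w)` regrouped to `T ∈ GL_N(E_v)`, the `w`-component of
`ᵗ((c ⊗ 1) T) · J_v · T` is `(c_* u_{c⁻¹ w})ᵀ · J_w · u_w` (the computation behind ★ `mem_localPi_iff`). [cite: PlatonovRapinchuk1994, §5.1] -/
theorem formCongr_localGLPiEquiv_symm_map_eval (u : LocalGLPi E N v) (w : PlacesOver E v) :
    (formCongr (conjLocal E c v) ((localGLPiEquiv E N v).symm u) ((adelicForm E N J).map (adeleToLocal E v))).map
        (Pi.evalRingHom (fun w : PlacesOver E v => w.1.adicCompletion E) w) =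
      (((u (PlacesOver.galInv c w) : GL (Fin N) ((PlacesOver.galInv c w).1.adicCompletion E)) :
            Matrix (Fin N) (Fin N) ((PlacesOver.galInv c w).1.adicCompletion E)).map
          (galAdicCompletionMap c (smul_inv_smul c w.1)))ᵀ * placeForm J w.1 *
        ((u w : GL (Fin N) (w.1.adicCompletion E)) : Matrix (Fin N) (Fin N) (w.1.adicCompletion E)) := by
  have hev : ∀ w : PlacesOver E v,
      ((((localGLPiEquiv E N v).symm u : GL (Fin N) (LocalRing E v)) : Matrix (Fin N) (Fin N) (LocalRing E v))).map
          (Pi.evalRingHom (fun w : PlacesOver E v => w.1.adicCompletion E) w) =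
        ((u w : GL (Fin N) (w.1.adicCompletion E)) : Matrix (Fin N) (Fin N) (w.1.adicCompletion E)) :=
    fun w => GLn.map_piEquiv_symm _ _ u w
  dsimp only [formCongr]
  rw [← RingHom.mapMatrix_apply, map_mul, map_mul, RingHom.mapMatrix_apply, RingHom.mapMatrix_apply,
    RingHom.mapMatrix_apply, Matrix.transpose_map, hev w, localForm_map_eval, ← hev (PlacesOver.galInv c w),
    Matrix.map_map, Matrix.map_map]
  rfl

/-- **«One equation suffices» for a change of form at a split place**: for `J, J'` hermitian, `c ≠ 1` and `w ∣ v`, if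
`(c_* u_{c⁻¹ w})ᵀ · J_w · u_w = J'_w` in `M_N(E_w)` then the same identity holds at the other place `c⁻¹ w` (its `c⁻¹`-transport,
transposed; twin of ★ `mem_localPi_iff_of_split` with two forms). [cite: PlatonovRapinchuk1994, §5.1] -/
theorem formCongr_eval_galInv_of_eval (hc : c ≠ 1) (hJ : (J.map c)ᵀ = J) (hJ' : (J'.map c)ᵀ = J') (w : PlacesOver E v)
    (u : LocalGLPi E N v)
    (h : (((u (PlacesOver.galInv c w) : GL (Fin N) ((PlacesOver.galInv c w).1.adicCompletion E)) :
            Matrix (Fin N) (Fin N) ((PlacesOver.galInv c w).1.adicCompletion E)).map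
          (galAdicCompletionMap c (smul_inv_smul c w.1)))ᵀ * placeForm J w.1 *
        ((u w : GL (Fin N) (w.1.adicCompletion E)) : Matrix (Fin N) (Fin N) (w.1.adicCompletion E)) = placeForm J' w.1) :
    (((u (PlacesOver.galInv c (PlacesOver.galInv c w)) :
            GL (Fin N) ((PlacesOver.galInv c (PlacesOver.galInv c w)).1.adicCompletion E)) :
            Matrix (Fin N) (Fin N) ((PlacesOver.galInv c (PlacesOver.galInv c w)).1.adicCompletion E)).map
          (galAdicCompletionMap c (smul_inv_smul c (PlacesOver.galInv c w).1)))ᵀ * placeForm J (PlacesOver.galInv c w).1 *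
        ((u (PlacesOver.galInv c w) : GL (Fin N) ((PlacesOver.galInv c w).1.adicCompletion E)) :
          Matrix (Fin N) (Fin N) ((PlacesOver.galInv c w).1.adicCompletion E)) = placeForm J' (PlacesOver.galInv c w).1 := by
  have hww : PlacesOver.galInv c (PlacesOver.galInv c w) = w := PlacesOver.galInv_galInv c hc w
  -- (1) `c⁻¹_* ∘ c_* = id` on matrices over `E_{c⁻¹ w}`
  have h2 : ∀ M : Matrix (Fin N) (Fin N) ((PlacesOver.galInv c w).1.adicCompletion E),
      (M.map (galAdicCompletionMap c (smul_inv_smul c w.1))).map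
        (galAdicCompletionMap c⁻¹ (rfl : c⁻¹ • w.1 = (PlacesOver.galInv c w).1)) = M := fun M =>
    Matrix.ext fun i j => galAdicCompletionMap_inv_apply E c (smul_inv_smul c w.1) rfl (M i j)
  -- (2) transport the `w`-identity along `c⁻¹_* : E_w → E_{c⁻¹ w}` and transpose it
  have h1 : (((u w : GL (Fin N) (w.1.adicCompletion E)) : Matrix (Fin N) (Fin N) (w.1.adicCompletion E)).map
        (galAdicCompletionMap c⁻¹ (rfl : c⁻¹ • w.1 = (PlacesOver.galInv c w).1)))ᵀ *
      (placeForm J (PlacesOver.galInv c w).1 *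
        ((u (PlacesOver.galInv c w) : GL (Fin N) ((PlacesOver.galInv c w).1.adicCompletion E)) :
          Matrix (Fin N) (Fin N) ((PlacesOver.galInv c w).1.adicCompletion E))) =
      placeForm J' (PlacesOver.galInv c w).1 := by
    have h1' := congrArg (fun M : Matrix (Fin N) (Fin N) (w.1.adicCompletion E) =>
      (M.map (galAdicCompletionMap c⁻¹ (rfl : c⁻¹ • w.1 = (PlacesOver.galInv c w).1)))ᵀ) h
    simp only [Matrix.map_mul, Matrix.transpose_mul, Matrix.transpose_map, Matrix.transpose_transpose, h2] at h1'
    rwa [← placeForm_inv_smul c J hc hJ w.1, ← placeForm_inv_smul c J' hc hJ' w.1] at h1'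
  -- (3) `c_* u_{c⁻¹ c⁻¹ w} = c⁻¹_* u_w` (`c⁻¹ c⁻¹ w = w`, `c = c⁻¹`)
  have h3 : ((u (PlacesOver.galInv c (PlacesOver.galInv c w)) :
        GL (Fin N) ((PlacesOver.galInv c (PlacesOver.galInv c w)).1.adicCompletion E)) :
          Matrix (Fin N) (Fin N) ((PlacesOver.galInv c (PlacesOver.galInv c w)).1.adicCompletion E)).map
      (galAdicCompletionMap c (smul_inv_smul c (PlacesOver.galInv c w).1)) =
      ((u w : GL (Fin N) (w.1.adicCompletion E)) : Matrix (Fin N) (Fin N) (w.1.adicCompletion E)).map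
        (galAdicCompletionMap c⁻¹ (rfl : c⁻¹ • w.1 = (PlacesOver.galInv c w).1)) := by
    have hcw : c • w.1 = (PlacesOver.galInv c w).1 := by
      change c • w.1 = c⁻¹ • w.1; rw [algEquiv_inv_eq_self F hc]
    exact congrArg (fun g : GL (Fin N) ((PlacesOver.galInv c w).1.adicCompletion E) =>
        (g : Matrix (Fin N) (Fin N) ((PlacesOver.galInv c w).1.adicCompletion E)))
      ((map_galAdicCompletionMap_congr_place hww (smul_inv_smul c (PlacesOver.galInv c w).1) hcw u).trans
        (map_galAdicCompletionMap_congr_left (algEquiv_inv_eq_self F hc).symm hcw rfl (u w)))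
  rw [h3, Matrix.mul_assoc]
  exact h1

open scoped Classical in
/-- **At a split place any two non-degenerate hermitian forms are congruent over `E_v`**: for `w ∣ v` with `c • w ≠ w`
(`E_v = E ⊗_F F_v = E_w × E_{c⁻¹ w}`) and `J, J' ∈ M_N(E)` `c`-hermitian with unit determinants there is `T ∈ GL_N(E_v)` with
`ᵗ((c ⊗ 1) T) · J_v · T = J'_v` — namely `T = (1, c⁻¹_*(J_w^{-ᵀ} · J'_w^{ᵀ}))` (hermitian forms over the split algebra `F_v × F_v` carry
no invariant; Mok: «for `v` split `U(N)(F_v) ≅ GL_N(F_v)`» whatever the form). [cite: Mok2014, §1 Notation p. 5] [cite: PlatonovRapinchuk1994, §2.3] -/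
theorem exists_formCongr_eq_of_split (hc : c ≠ 1) (hJ : (J.map c)ᵀ = J) (hJ' : (J'.map c)ᵀ = J') (hJd : IsUnit J.det)
    (hJ'd : IsUnit J'.det) (w : PlacesOver E v) (hw : c • w.1 ≠ w.1) :
    ∃ T : GL (Fin N) (LocalRing E v),
      formCongr (conjLocal E c v) T (J.map (algebraMap E (LocalRing E v))) = J'.map (algebraMap E (LocalRing E v)) := by
  -- the two forms at `w`, as units, and the `c⁻¹ w`-component `X = J_w^{-ᵀ} J'_w^{ᵀ}`
  set Jw : GL (Fin N) (w.1.adicCompletion E) := (isUnit_placeForm_of_isUnit_det hJd w.1).unit with hJw_def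
  set J'w : GL (Fin N) (w.1.adicCompletion E) := (isUnit_placeForm_of_isUnit_det hJ'd w.1).unit with hJ'w_def
  have hJw : (Jw : Matrix (Fin N) (Fin N) (w.1.adicCompletion E)) = placeForm J w.1 :=
    (isUnit_placeForm_of_isUnit_det hJd w.1).unit_spec
  have hJ'w : (J'w : Matrix (Fin N) (Fin N) (w.1.adicCompletion E)) = placeForm J' w.1 :=
    (isUnit_placeForm_of_isUnit_det hJ'd w.1).unit_spec
  set X : GL (Fin N) (w.1.adicCompletion E) := GLn.contragredient Jw * (GLn.contragredient J'w)⁻¹ with hX_def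
  have hX : ((X : GL (Fin N) (w.1.adicCompletion E)) : Matrix (Fin N) (Fin N) (w.1.adicCompletion E))ᵀ * placeForm J w.1 =
      placeForm J' w.1 := by
    rw [hX_def, Units.val_mul, Matrix.transpose_mul, GLn.coe_contragredient_inv, GLn.coe_contragredient_transpose,
      Matrix.transpose_transpose, ← hJw, Matrix.mul_assoc, ← Units.val_mul, inv_mul_cancel, Units.val_one, Matrix.mul_one, hJ'w]
  -- the family `u = (1 at w, c⁻¹_* X at c⁻¹ w)` and `T`
  let u : LocalGLPi E N v := fun w' =>
    Matrix.GeneralLinearGroup.map (galAdicCompletionMap (splitGal c w w') (splitGal_smul c hc w w')) (if w'.1 = w.1 then 1 else X)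
  have huw : u w = 1 := by
    change Matrix.GeneralLinearGroup.map _ (if w.1 = w.1 then 1 else X) = 1
    rw [if_pos rfl, map_one]
  have hne : (PlacesOver.galInv c w).1 ≠ w.1 := fun h => PlacesOver.galInv_ne c w hw (Subtype.ext h)
  have hug : ((u (PlacesOver.galInv c w) : GL (Fin N) ((PlacesOver.galInv c w).1.adicCompletion E)) :
        Matrix (Fin N) (Fin N) ((PlacesOver.galInv c w).1.adicCompletion E)).map (galAdicCompletionMap c (smul_inv_smul c w.1)) =
      ((X : GL (Fin N) (w.1.adicCompletion E)) : Matrix (Fin N) (Fin N) (w.1.adicCompletion E)) := by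
    have hu' : u (PlacesOver.galInv c w) =
        Matrix.GeneralLinearGroup.map (galAdicCompletionMap c⁻¹ (rfl : c⁻¹ • w.1 = (PlacesOver.galInv c w).1)) X := by
      change Matrix.GeneralLinearGroup.map _ (if (PlacesOver.galInv c w).1 = w.1 then 1 else X) = _
      rw [if_neg hne, map_galAdicCompletionMap_congr_left (splitGal_of_ne c hne)]
    rw [hu']
    exact congrArg (fun g : GL (Fin N) (w.1.adicCompletion E) => (g : Matrix (Fin N) (Fin N) (w.1.adicCompletion E)))
      (map_galAdicCompletionMap_apply_inv c (smul_inv_smul c w.1) rfl X)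
  -- the identity at `w`, hence at both places above `v`
  have hw_eq : (((u (PlacesOver.galInv c w) : GL (Fin N) ((PlacesOver.galInv c w).1.adicCompletion E)) :
          Matrix (Fin N) (Fin N) ((PlacesOver.galInv c w).1.adicCompletion E)).map
        (galAdicCompletionMap c (smul_inv_smul c w.1)))ᵀ * placeForm J w.1 *
      ((u w : GL (Fin N) (w.1.adicCompletion E)) : Matrix (Fin N) (Fin N) (w.1.adicCompletion E)) = placeForm J' w.1 := by
    rw [hug, huw, Units.val_one, Matrix.mul_one, hX]
  refine ⟨(localGLPiEquiv E N v).symm u, ?_⟩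
  rw [← adelicForm_map_adeleToLocal, ← adelicForm_map_adeleToLocal, Matrix.eq_iff_forall_map_evalRingHom]
  intro w''
  rw [formCongr_localGLPiEquiv_symm_map_eval, localForm_map_eval]
  rcases PlacesOver.eq_or_eq_galInv c hc w w'' with rfl | rfl
  · exact hw_eq
  · exact formCongr_eval_galInv_of_eval c hc hJ hJ' w u hw_eq

/-- The same in the similitude currency of ★ `localFormCongr` ∕ `cmDatumLocalCongr` (`ᵗ((c ⊗ 1) T) · J_v · T = a • J'_v`, `a` a
`(c ⊗ 1)`-fixed unit): at a split place one may take `a = 1`. [cite: PlatonovRapinchuk1994, §2.3] -/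
theorem exists_isUnit_formCongr_eq_smul_of_split (hc : c ≠ 1) (hJ : (J.map c)ᵀ = J) (hJ' : (J'.map c)ᵀ = J') (hJd : IsUnit J.det)
    (hJ'd : IsUnit J'.det) (w : PlacesOver E v) (hw : c • w.1 ≠ w.1) :
    ∃ (T : GL (Fin N) (LocalRing E v)) (a : LocalRing E v), IsUnit a ∧ conjLocal E c v a = a ∧
      formCongr (conjLocal E c v) T (J.map (algebraMap E (LocalRing E v))) = a • J'.map (algebraMap E (LocalRing E v)) := by
  obtain ⟨T, hT⟩ := exists_formCongr_eq_of_split c hc hJ hJ' hJd hJ'd w hw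
  exact ⟨T, 1, isUnit_one, map_one _, by rw [hT, one_smul]⟩

end Split

/-! ## §2 Along the conjugation by a local similitude every element corresponds to its image -/

/-- **`γ′ ↔ T γ′ T⁻¹`**: along ★ `localFormCongr c v T ha h : U(J')(F_v) ≃ₜ* U(J)(F_v)` (conjugation by a local similitude `T`) every
`γ′ ∈ U(J')(F_v)` CORRESPONDS to its image in the sense of [Rogawski1990, §14.1] (★ `Rogawski1990.Corresponds` = conjugacy in the common
`GL_N(E_v)`; conjugator `T`). [cite: Rogawski1990, §14.1 p. 232] -/
theorem corresponds_localFormCongr (v : HeightOneSpectrum (𝓞 F)) (T : GL (Fin N) (LocalRing E v)) {a : LocalRing E v} (ha : IsUnit a)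
    {J J' : Matrix (Fin N) (Fin N) E}
    (h : formCongr (conjLocal E c v) T (J.map (algebraMap E (LocalRing E v))) = a • J'.map (algebraMap E (LocalRing E v)))
    (γ' : «local» E c N J' v) :
    Corresponds (conjLocal E c v) ((adelicForm E N J').map (adeleToLocal E v)) ((adelicForm E N J).map (adeleToLocal E v))
      γ' (localFormCongr c v T ha h γ') :=
  isConj_iff.2 ⟨T, rfl⟩

/-- **`T⁻¹ γ T ↔ γ`** for the inverse isomorphism `(localFormCongr c v T ha h).symm : U(J)(F_v) ≃ₜ* U(J')(F_v)`. [cite: Rogawski1990, §14.1 p. 232] -/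
theorem corresponds_localFormCongr_symm (v : HeightOneSpectrum (𝓞 F)) (T : GL (Fin N) (LocalRing E v)) {a : LocalRing E v}
    (ha : IsUnit a) {J J' : Matrix (Fin N) (Fin N) E}
    (h : formCongr (conjLocal E c v) T (J.map (algebraMap E (LocalRing E v))) = a • J'.map (algebraMap E (LocalRing E v)))
    (γ : «local» E c N J v) :
    Corresponds (conjLocal E c v) ((adelicForm E N J').map (adeleToLocal E v)) ((adelicForm E N J).map (adeleToLocal E v))
      ((localFormCongr c v T ha h).symm γ) γ :=
  isConj_iff.2 ⟨T, by rw [coe_localFormCongr_symm_apply, ← mul_assoc, ← mul_assoc, mul_inv_cancel, one_mul, mul_assoc,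
    mul_inv_cancel, mul_one]⟩

end Generic

/-! ## §3 The CM case in rank `3`: a similitude onto `a • Φ₃` at EVERY finite place, and the induced `ψ_v` with `γ′ ↔ ψ_v γ′` -/

section CM

variable (L : Type) [Field L] [NumberField L] [IsCMField L] {N : ℕ}

/-- `cmDatum` twin of `corresponds_localFormCongr`: along ★ `cmDatumLocalCongr L v T ha h : U(H')(L⁺_v) ≃ₜ* U(H)(L⁺_v)`, `γ′ ↔ T γ′ T⁻¹`.
[cite: Rogawski1990, §14.1 p. 232] -/
theorem corresponds_cmDatumLocalCongr {H H' : Matrix (Fin N) (Fin N) L} (v : HeightOneSpectrum (𝓞 ↥(maximalRealSubfield L)))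
    (T : GL (Fin N) (LocalRing L v)) {a : LocalRing L v} (ha : IsUnit a)
    (h : formCongr (conjLocal L (IsCMField.complexConj L) v) T (H.map (algebraMap L (LocalRing L v))) =
      a • H'.map (algebraMap L (LocalRing L v))) (γ' : (cmDatum L N H').Local v) :
    Corresponds (conjLocal L (IsCMField.complexConj L) v) ((adelicForm L N H').map (adeleToLocal L v))
      ((adelicForm L N H).map (adeleToLocal L v)) γ' (cmDatumLocalCongr L v T ha h γ') :=
  corresponds_localFormCongr (IsCMField.complexConj L) v T ha h γ'

/-- `cmDatum` twin of `corresponds_localFormCongr_symm`: `T⁻¹ γ T ↔ γ` along `(cmDatumLocalCongr L v T ha h).symm`.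
[cite: Rogawski1990, §14.1 p. 232] -/
theorem corresponds_cmDatumLocalCongr_symm {H H' : Matrix (Fin N) (Fin N) L} (v : HeightOneSpectrum (𝓞 ↥(maximalRealSubfield L)))
    (T : GL (Fin N) (LocalRing L v)) {a : LocalRing L v} (ha : IsUnit a)
    (h : formCongr (conjLocal L (IsCMField.complexConj L) v) T (H.map (algebraMap L (LocalRing L v))) =
      a • H'.map (algebraMap L (LocalRing L v))) (γ : (cmDatum L N H).Local v) :
    Corresponds (conjLocal L (IsCMField.complexConj L) v) ((adelicForm L N H').map (adeleToLocal L v))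
      ((adelicForm L N H).map (adeleToLocal L v)) ((cmDatumLocalCongr L v T ha h).symm γ) γ :=
  corresponds_localFormCongr_symm (IsCMField.complexConj L) v T ha h γ

/-- **A local similitude onto the split form at EVERY finite place** ([Rogawski1990, §14.2 p. 232 (i)–(iii)] for `D = M₃(L)`: the set `S`
is empty): for `H ∈ M₃(L)` anisotropic and hermitian and every finite place `v` of `L⁺` there are `T ∈ GL₃(L ⊗ L⁺_v)` and a
`(c ⊗ 1)`-fixed unit `a` with `ᵗ(T̄) · H_v · T = a • (Φ₃)_v`, `Φ₃ = antidiag(1,1,1)`. Split `v`: §1 (`a = 1`); non-split `v`: the rank-3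
classification ★ `exists_formCongr_map_eq_smul_antidiag_of_smul_eq` (`det H ≠ 0` by ★ `Godement.det_ne_zero_of_anisotropic`).
[cite: Rogawski1990, §14.2 p. 232] -/
theorem exists_isUnit_formCongr_cmDatum_antidiagThree (H : Matrix (Fin 3) (Fin 3) L)
    (hanis : ∀ x : Fin 3 → L, hermForm (cmConjRingHom L) H x x = 0 → x = 0) (hherm : (H.map (cmConjRingHom L))ᵀ = H)
    (v : HeightOneSpectrum (𝓞 ↥(maximalRealSubfield L))) :
    ∃ (T : GL (Fin 3) (LocalRing L v)) (a : LocalRing L v), IsUnit a ∧ conjLocal L (IsCMField.complexConj L) v a = a ∧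
      formCongr (conjLocal L (IsCMField.complexConj L) v) T (H.map (algebraMap L (LocalRing L v))) =
        a • (Matrix.of fun i j : Fin 3 => if i.val + j.val + 1 = 3 then (1 : L) else 0).map (algebraMap L (LocalRing L v)) := by
  have hHd : H.det ≠ 0 := Godement.det_ne_zero_of_anisotropic L H hanis
  obtain ⟨w⟩ : Nonempty (PlacesOver L v) := inferInstance
  by_cases hw : IsCMField.complexConj L • w.1 = w.1
  · exact exists_formCongr_map_eq_smul_antidiag_of_smul_eq L (IsCMField.complexConj L) (IsCMField.complexConj_ne_one L) H
      hherm hHd w hw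
  · exact exists_isUnit_formCongr_eq_smul_of_split (IsCMField.complexConj L) (IsCMField.complexConj_ne_one L)
      ((map_cmConjRingHom_eq_map_complexConj L H) ▸ hherm) (antidiagOne_isHermitian L 3) (isUnit_iff_ne_zero.2 hHd)
      (isUnit_antidiagOne_det L 3) w hw

/-- **The local identification `ψ_v : U(H)(L⁺_v) ≃ₜ* U(Φ₃)(L⁺_v)` as conjugation by a similitude, with `γ′ ↔ ψ_v γ′`** — the socket of
the anchored local transfer (14.2.1) at the finite places [Rogawski1990, §14.2]: for `H` anisotropic hermitian and every finite `v` there are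
`T ∈ GL₃(L ⊗ L⁺_v)` and an isomorphism of topological groups `e` with `e g = T⁻¹ g T` on matrices, `γ′ ↔ e γ′` for every `γ′ ∈ U(H)(L⁺_v)`
and `e⁻¹ γ ↔ γ` for every `γ ∈ U(Φ₃)(L⁺_v)` (so every regular `γ` «occurs», the vanishing branch of (14.2.1) is vacuous at `v`); `e` is
`(cmDatumLocalCongr L v T ha h).symm` for the similitude of `exists_isUnit_formCongr_cmDatum_antidiagThree`.
[cite: Rogawski1990, §14.2 (14.2.1) p. 232] -/
theorem exists_cmDatum_localEquiv_corresponds (H : Matrix (Fin 3) (Fin 3) L)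
    (hanis : ∀ x : Fin 3 → L, hermForm (cmConjRingHom L) H x x = 0 → x = 0) (hherm : (H.map (cmConjRingHom L))ᵀ = H)
    (v : HeightOneSpectrum (𝓞 ↥(maximalRealSubfield L))) :
    ∃ (T : GL (Fin 3) (LocalRing L v)) (e : (cmDatum L 3 H).Local v ≃ₜ*
        (cmDatum L 3 (Matrix.of fun i j : Fin 3 => if i.val + j.val + 1 = 3 then (1 : L) else 0)).Local v),
      (∀ g : (cmDatum L 3 H).Local v, ((e g).val : GL (Fin 3) (LocalRing L v)) = T⁻¹ * g.val * T) ∧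
      (∀ γ' : (cmDatum L 3 H).Local v,
        Corresponds (conjLocal L (IsCMField.complexConj L) v) ((adelicForm L 3 H).map (adeleToLocal L v))
          ((adelicForm L 3 (Matrix.of fun i j : Fin 3 => if i.val + j.val + 1 = 3 then (1 : L) else 0)).map (adeleToLocal L v))
          γ' (e γ')) ∧
      ∀ γ : (cmDatum L 3 (Matrix.of fun i j : Fin 3 => if i.val + j.val + 1 = 3 then (1 : L) else 0)).Local v,
        Corresponds (conjLocal L (IsCMField.complexConj L) v) ((adelicForm L 3 H).map (adeleToLocal L v))
          ((adelicForm L 3 (Matrix.of fun i j : Fin 3 => if i.val + j.val + 1 = 3 then (1 : L) else 0)).map (adeleToLocal L v))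
          (e.symm γ) γ := by
  obtain ⟨T, a, ha, -, h⟩ := exists_isUnit_formCongr_cmDatum_antidiagThree L H hanis hherm v
  refine ⟨T, (cmDatumLocalCongr L v T ha h).symm, fun g => rfl,
    fun γ' => corresponds_comm.1 (corresponds_cmDatumLocalCongr_symm L v T ha h γ'), fun γ => ?_⟩
  rw [ContinuousMulEquiv.symm_symm]
  exact corresponds_comm.1 (corresponds_cmDatumLocalCongr L v T ha h γ)

end CM

end UnitaryGroup

end Literature.NumberTheory.Automorphic

end
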